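import Summits.HodgeConjecture.HodgeConjecture.Cruxes.BlochSeedDiscOne.LeggedFloor
import Summits.HodgeConjecture.HodgeConjecture.Cruxes.BlochSeedDiscOne.HallB136

/-!
line stmt-HodgeConjecture-18881 Cruxes/BlochSeedDiscOne/Lines/birth.lean 814a6a70c14e831a stub_rung_pad4_seedAt

# RuleDPlate — the director's (R3) ADOPTION ORDER, typed over ONE set of names: the door-(H2) RULE-D plate, the door-1 surplus rows beside
# `HallB136.HallUp`, their transport along the height tower, and the STATEMENT OF RECORD v4.1 `S⁺` as a `Prop` family (NO stub registered)
(plan-lens-HodgeAV-dual g13; director-hodge R19.614 (R3) (a)–(d), amended R19.619 ((A4).2 STRUCK), R19.621 (v4.1 = v4.0 ∧ `Disj`), R19.622 (tree `(A1)`),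
R19.623, R19.625 («DUAL: MODULE GO, ITEM WAITS FOR j341853»); claim-free; kit 0.)

LETTER-MODEL BOOKKEEPING ONLY (`DepthBoundA4.Design`): a design is not a sheaf, not a display, not a SEED; NOTHING here is proved toward
HC ∕ HC_CM ∕ HC_AV ∕ №4 ∕ 26512 ∕ 18881 ∕ H2 ∕ any `S⁺`; `Nonex 14 199 8` stays REFUTED as typed (`RotatedPairB136.not_nonex_fourteen`); the h = 6 certificate
programme is FROZEN (R19.600) and untouched here.  No new `instance`, no notation, no `axiom`, no `native_decide`; imports the TREE modules `LeggedFloor`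
(a2bfca588d6c ∕ 7792ac714d69b682: `NullStep ∕ Supplies ∕ Detects ∕ RuleDP ∕ RuleD ∕ Disj ∕ A4N`, THE names of door (H2)) and `HallB136` (3023ab44701e ∕ 698fcfaf11f90807:
`HallUp`, THE name of door 1) — nothing is restated under a second name.

## ONE NAME per door (R19.614 (a)(b))
* door 1: `HallB136.HallUp` (WeakLive = EQUAL ∕ NULL ∕ AMPLE on every factor = «effective arrow for some Pic⁰ twist», so `HallUp` IS the audit's `HallEff`);
  the surplus row `HallPlusUp E k` below is hsemireg-monad-2 g6's `HallRows.HallPlusUp` VERBATIM (HOME `HallRows-monad2-g6.lean` 5ee3608c504802c6, R19.615 (d)),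
  `PortHall₈ = HallPlus(8) = H_Hall⁺ := HallPlusUp E 8`, with the bridge `hallUp_iff_hallPlusUp_zero` ∕ `hallUp_of_hallPlusUp` to the tree name.
* door (H2): `LeggedFloor.RuleD` (text = idea-crit-hsem-3 g15 memo-152 `B136Door2Plate.RuleD` 1e086b967cf91d68 with the P-clause named `RuleDP`); §1 is hsem-3's
  PLATE re-proved over the tree names (their four `Decidable` instances are DROPPED — typer lint; the closed-term refutation `not_ruleD B136` stays in a
  probe file), incl. `mu_eq_zero_of_a4sharp_ruleD` («(A4♯) ∧ RuleD ⇒ μ = 0», no alphabet ∕ (A1) ∕ budget used) and `ruleD_shiftD`.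
* s4-search-1 g35 `LeggedRoomVacuous.lean` 21ff6a261a08f27d is MERGED with `LeggedFloor` (one name: s4's `CoverN` = `LeggedFloor.A4N`, s4's descent =
  `LeggedFloor.mu_eq_zero_of_a4N_ruleDP`); only its corollary `sPlusCycle_vacuous` is re-derived here (§2), with attribution.

## What is proved (all hypothesis-free rewrites ∕ implications about the typed letter model)
§1 suppliers are weakly live and never Live; (A4♯) ∧ RuleD ⇒ no detecting block ⇒ `μ = 0` (`mu_eq_zero_of_a4sharp_ruleD`, `nonexSharp_ruleD`);
   shift invariance `nullStep_shiftL`, `supplies_shiftCell`, `detects_shiftCell`, `ruleDP_shiftD`, `ruleD_shiftD`, `notDead_shiftL`, `weakLive_shiftCell`,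
   `a4sharp_shiftD`, `disj_shiftD`, `shiftCell_injective`.
§2 `sPlusCycle_vacuous` (s4): with `A4N` in the hypothesis set, «OnAlphabet h ∧ Φ ∧ A4N ∧ RuleD ∧ μ ≠ 0» is unsatisfiable for EVERY `Φ` — the reason
   (A4).2 is STRUCK from the item (R19.619) and the item below carries `RuleD ∧ Disj` instead.
§3 `HallPlusUp`, `HallPlusAmpleUp`, monotonicity, `sumP_add_le_sumN_of_hallPlusUp`, `hallUp_iff_hallPlusUp_zero`, `hallUp_of_hallPlusUp`,
   `eight_le_rank_of_hallPlusUp` (the letter model's «8 ≤ rank» is the top instance of PortHall₈ on a design with a non-empty P side).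
§4 transport of the door-1 rows along ANY injective cell map preserving `WeakLive` (`hallUp_mapD`, `hallPlusUp_mapD`; with `Live` also
   `hallPlusAmpleUp_mapD`), hence along the tower: `hallUp_shiftD`, `hallPlusUp_shiftD`, `hallPlusAmpleUp_shiftD` (R19.614 (c)).
§5 THE ITEM, typed (R19.621 statement of record v4.1, NOT registered as a stub — director's word pending, R19.609 ∕ R19.617):
   `SPlus h σ π := ∀ D, OnAlphabet h D → Disj D → D.A1 → RuleD D → HallUp D → HallPlusUp D 8 → D.mu ≠ 0 → σ D + 28·(D.rank − 4) + π ≤ 3136 → False`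
   where `(A1)` is the TREE form `DepthBoundA4.Design.A1` (R19.622) and `σ : Design → ℤ` is the CERTIFICATE-FED cycle-door functional Σ-H
   (hsemireg-c4-1 g28 `C4-HGEN-BUDGET` §1.8: a min-cut over Pic⁰-label strata, no closed form on legged rooms — so it enters as a PARAMETER; the
   `28·(r − 4)` term is closed-form arithmetic in `D.rank`, cf. `C4FrameCharge.covered_budget_iff`; `π` is semihom-1's PGL-piece rider, a PARAMETER not
   baked in, R19.625 (i)).  The general form `SPlusB h Budget` takes any budget predicate (`Budget := fun _ => True` is the budget-free room R19.623
   reports INHABITED on ring 2 modulo the Hall rows; `CopiesLe B` is the sheaf-door count); `Room h Door Budget` abstracts the door as well, and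
   monad-2 g7's §4 rider «RULE D with suppliers ≠ the cell, no `Disj`» is typed as `RuleDStrict` ∕ `SPlusS` with `sPlusB_of_sPlusS` (R19.625: `Disj` stands,
   both typed).
   THE TOWER TRANSPORTS EVERY ADDED HYPOTHESIS (R19.614 (c)), proved once for the generic room (`room_succ_iff`, `room_add_iff`) and instantiated:
   `sPlusB_of_sPlusB_up` (down-inheritance), `FloorFreeB`, `sPlusB_succ_iff` (`S⁺(h+1) ↔ S⁺(h) ∧ FloorFree⁺(h+1)`), `sPlusB_add_iff` (n storeys),
   `sPlus_succ_iff ∕ sPlus_add_iff`, `sPlusS_succ_iff`, under the single side condition that the budget predicate is shift-invariant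
   (`budgetClause_shiftD`: automatic for the clause of record once `σ (shiftD t D) = σ D`; `copiesLe_shiftD`).  (A4).1, CONN.2, strongA1 are REPORTED
   COLUMNS of the scans, not conjuncts (R19.619 ∕ R19.622), and are not typed into the item.
-/

set_option linter.dupNamespace false
set_option autoImplicit false

namespace Summit.HodgeConjecture.HodgeConjecture.Cruxes.BlochSeedDiscOne.RuleDPlate

open Summit.HodgeConjecture.HodgeConjecture.Cruxes.BlochSeedDiscOne.DepthBoundA4
open Summit.HodgeConjecture.HodgeConjecture.Cruxes.BlochSeedDiscOne.HeightTower
open Summit.HodgeConjecture.HodgeConjecture.Cruxes.BlochSeedDiscOne.LeggedFloor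
open Summit.HodgeConjecture.HodgeConjecture.Cruxes.BlochSeedDiscOne.HallB136

/-! ## §1 Door (H2): the RULE-D plate over the tree names (idea-crit-hsem-3 g15 memo-152 `B136Door2Plate`, re-proved over `LeggedFloor.RuleD`) -/

theorem notDead_of_eq_or_null {ℓ ℓ' : Letter} (h : ℓ = ℓ' ∨ NullStep ℓ ℓ') : NotDead ℓ ℓ' := by
  rcases h with h | h
  · exact Or.inl h
  · exact Or.inr ⟨h.1, le_of_eq h.2⟩

/-- a supplier pair is weakly live (EQUAL ∕ NULL on the block, EQUAL off it). -/
theorem weakLive_of_supplies {x y : Cell} {g j : Fin 4} (h : Supplies x y g j) : WeakLive x y := by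
  intro f
  obtain ⟨hoff, hg, hj⟩ := h
  by_cases hfg : f = g
  · subst hfg; exact notDead_of_eq_or_null hg
  by_cases hfj : f = j
  · subst hfj; exact notDead_of_eq_or_null hj
  exact Or.inl (hoff f hfg hfj)

theorem not_ampleAbove_of_eq_or_null {ℓ ℓ' : Letter} (h : ℓ = ℓ' ∨ NullStep ℓ ℓ') : ¬ AmpleAbove ℓ ℓ' := by
  intro ha
  rcases h with h | h
  · rw [h] at ha; exact lt_irrefl _ ha.1
  · exact (ne_of_lt ha.2) h.2

/-- … and never four-ample. -/
theorem not_live_of_supplies {x y : Cell} {g j : Fin 4} (h : Supplies x y g j) : ¬ Live x y :=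
  fun hl => not_ampleAbove_of_eq_or_null h.2.1 (hl g)

/-- Under (A4♯) there is no supplier pair between supported cells. -/
theorem no_supplier_of_a4sharp (D : Design) (hs : D.A4sharp) {x y : Cell} (hx : x ∈ D.suppP) (hy : y ∈ D.suppN)
    {g j : Fin 4} (h : Supplies x y g j) : False :=
  not_live_of_supplies h (hs x hx y hy (weakLive_of_supplies h))

/-- Under (A4♯), RULE D forces every supported cell to have NO detecting block. -/
theorem not_detects_of_a4sharp_ruleD (D : Design) (hs : D.A4sharp) (hr : RuleD D) :
    (∀ y ∈ D.suppN, ∀ g j : Fin 4, g < j → ¬ Detects y g j) ∧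
    (∀ x ∈ D.suppP, ∀ g j : Fin 4, g < j → ¬ Detects x g j) := by
  refine ⟨fun y hy g j hgj hd => ?_, fun x hx g j hgj hd => ?_⟩
  · obtain ⟨x, hx, hsup⟩ := hr.1 y hy g j hgj hd
    exact no_supplier_of_a4sharp D hs hx hy hsup
  · obtain ⟨y, hy, hsup⟩ := ruleDP_of_ruleD D hr x hx g j hgj hd
    exact no_supplier_of_a4sharp D hs hx hy hsup

/-- A cell whose `(0,1)` block is non-detecting has `β₀ = 0`, hence `cellCoef c eeee = ∏ β̄_f = 0`. -/
theorem cellCoef_eeee_eq_zero_of_not_detects {c : Cell} (h : ¬ Detects c 0 1) : cellCoef c Word.eeee = 0 := by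
  simp only [Detects, not_not] at h
  have hb : (c 0).beta = 0 := by
    ext <;> simp [Letter.beta, h.1, h.2.1]
  rw [cellCoef]
  apply Finset.prod_eq_zero (Finset.mem_univ (0 : Fin 4))
  simp [Word.eeee, Sym.coef, hb]

/-- **(A4♯) ∧ RuleD ⇒ μ = 0** (hsem-3's universal form; no alphabet, (A1), CONN, copies, rank or budget hypothesis is used). -/
theorem mu_eq_zero_of_a4sharp_ruleD (D : Design) (hs : D.A4sharp) (hr : RuleD D) : D.mu = 0 := by
  have hnd := not_detects_of_a4sharp_ruleD D hs hr
  have hN : (D.N.map fun cm => (cm.2 : GaussianInt) * cellCoef cm.1 Word.eeee).sum = 0 := by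
    apply listSum_eeee_eq_zero
    intro cm hcm h0
    have hmem : cm.1 ∈ D.suppN := (mem_suppN_iff D cm.1).mpr ⟨cm.2, hcm, h0⟩
    exact cellCoef_eeee_eq_zero_of_not_detects (hnd.1 cm.1 hmem 0 1 (by decide))
  have hP : (D.P.map fun cm => (cm.2 : GaussianInt) * cellCoef cm.1 Word.eeee).sum = 0 := by
    apply listSum_eeee_eq_zero
    intro cm hcm h0
    have hmem : cm.1 ∈ D.suppP := (mem_suppP_iff D cm.1).mpr ⟨cm.2, hcm, h0⟩
    exact cellCoef_eeee_eq_zero_of_not_detects (hnd.2 cm.1 hmem 0 1 (by decide))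
  show D.T Word.eeee = 0
  rw [Design.T, hN, hP, sub_zero]

/-- Contrapositive: an (A4♯) design with `μ ≠ 0` violates RULE D (door (H2)). -/
theorem not_ruleD_of_a4sharp_mu_ne (D : Design) (hs : D.A4sharp) (hμ : D.mu ≠ 0) : ¬ RuleD D :=
  fun hr => hμ (mu_eq_zero_of_a4sharp_ruleD D hs hr)

/-- `A4sharp`, `RuleD`, `μ ≠ 0` are jointly unsatisfiable (the four-ample room is door-(H2)-dead). -/
theorem nonexSharp_ruleD (D : Design) (hs : D.A4sharp) (hr : RuleD D) (hμ : D.mu ≠ 0) : False :=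
  not_ruleD_of_a4sharp_mu_ne D hs hμ hr

/-! ### Shift invariance of the door-(H2) predicates (incidence only sees differences and `β`) -/

theorem nullStep_shiftL (t : ℤ) (ℓ ℓ' : Letter) : NullStep (shiftL t ℓ) (shiftL t ℓ') ↔ NullStep ℓ ℓ' := by
  simp only [NullStep, shiftL_a, shiftL_x, shiftL_y, add_lt_add_iff_right, add_sub_add_right_eq_sub]

theorem shiftL_inj' (t : ℤ) (ℓ ℓ' : Letter) : shiftL t ℓ = shiftL t ℓ' ↔ ℓ = ℓ' := by
  obtain ⟨a, x, y⟩ := ℓ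
  obtain ⟨a', x', y'⟩ := ℓ'
  simp [shiftL]

theorem shiftCell_injective (t : ℤ) : Function.Injective (shiftCell t) := by
  intro x y h
  funext f
  exact (shiftL_inj' t (x f) (y f)).mp (congrFun h f)

theorem supplies_shiftCell (t : ℤ) (x y : Cell) (g j : Fin 4) :
    Supplies (shiftCell t x) (shiftCell t y) g j ↔ Supplies x y g j := by
  simp only [Supplies, shiftCell, shiftL_inj', nullStep_shiftL]

theorem detects_shiftCell (t : ℤ) (c : Cell) (g j : Fin 4) : Detects (shiftCell t c) g j ↔ Detects c g j := by
  simp only [Detects, shiftCell, shiftL_x, shiftL_y, shiftL_a, add_left_inj]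

theorem exists_mem_map_iff' {α β : Type} (f : α → β) (L : List α) (P : β → Prop) :
    (∃ b ∈ L.map f, P b) ↔ ∃ a ∈ L, P (f a) := by
  constructor
  · rintro ⟨b, hb, hP⟩
    obtain ⟨a, ha, rfl⟩ := List.mem_map.mp hb
    exact ⟨a, ha, hP⟩
  · rintro ⟨a, ha, hP⟩
    exact ⟨f a, List.mem_map.mpr ⟨a, ha, rfl⟩, hP⟩

/-- RULE D's P-clause is shift-invariant. -/
theorem ruleDP_shiftD (t : ℤ) (D : Design) : RuleDP (shiftD t D) ↔ RuleDP D := by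
  simp only [RuleDP, suppN_shift, suppP_shift, List.forall_mem_map, exists_mem_map_iff', supplies_shiftCell,
    detects_shiftCell]

/-- RULE D is shift-invariant (hsem-3's `ruleD_shiftD`, over the tree name). -/
theorem ruleD_shiftD (t : ℤ) (D : Design) : RuleD (shiftD t D) ↔ RuleD D := by
  simp only [RuleD, RuleDP, suppN_shift, suppP_shift, List.forall_mem_map, exists_mem_map_iff', supplies_shiftCell,
    detects_shiftCell]

theorem notDead_shiftL (t : ℤ) (ℓ ℓ' : Letter) : NotDead (shiftL t ℓ) (shiftL t ℓ') ↔ NotDead ℓ ℓ' := by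
  simp only [NotDead, shiftL_inj', shiftL_a, shiftL_x, shiftL_y, add_lt_add_iff_right, add_sub_add_right_eq_sub]

theorem weakLive_shiftCell (t : ℤ) (x y : Cell) : WeakLive (shiftCell t x) (shiftCell t y) ↔ WeakLive x y := by
  simp only [WeakLive, shiftCell, notDead_shiftL]

theorem a4sharp_shiftD (t : ℤ) (E : Design) : (shiftD t E).A4sharp ↔ E.A4sharp := by
  simp only [Design.A4sharp, suppN_shift, suppP_shift, List.forall_mem_map, weakLive_shiftCell, live_shiftCell]

/-- disjointness of supports is shift-invariant (the shift is injective on cells). -/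
theorem disj_shiftD (t : ℤ) (E : Design) : Disj (shiftD t E) ↔ Disj E := by
  constructor
  · intro h c hN hP
    exact h (shiftCell t c) (by rw [suppN_shift]; exact List.mem_map.mpr ⟨c, hN, rfl⟩)
      (by rw [suppP_shift]; exact List.mem_map.mpr ⟨c, hP, rfl⟩)
  · intro h c hN hP
    rw [suppN_shift, List.mem_map] at hN
    rw [suppP_shift, List.mem_map] at hP
    obtain ⟨c₁, hc₁, rfl⟩ := hN
    obtain ⟨c₂, hc₂, he⟩ := hP
    have e : c₂ = c₁ := shiftCell_injective t he
    rw [e] at hc₂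
    exact h c₁ hc₁ hc₂

/-! ## §2 The (A4).2 room is vacuous under RULE D (s4-search-1 g35 `LeggedRoomVacuous.sPlusCycle_vacuous` 21ff6a261a08f27d, over `LeggedFloor`) -/

/-- Whatever the remaining conjuncts `Φ`, «OnAlphabet h ∧ Φ ∧ (A4).2 ∧ RuleD ∧ μ ≠ 0» is unsatisfiable at every height
(`LeggedFloor.legged_a4N_ruleDP_vacuous`; s4's `CoverN` is the tree's `A4N`). -/
theorem sPlusCycle_vacuous (h : ℤ) (Φ : Design → Prop) :
    ∀ D : Design, D.OnAlphabet h → Φ D → A4N D → RuleD D → D.mu ≠ 0 → False :=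
  fun D hA _ hC hR hμ => legged_a4N_ruleDP_vacuous h D hA hC (ruleDP_of_ruleD D hR) hμ

/-- the same on the full (A4) room of `DepthBoundA4` (both halves). -/
theorem a4Room_ruleD_vacuous (h : ℤ) (D : Design) (hA : D.OnAlphabet h) (h4 : D.A4) (hR : RuleD D) (hμ : D.mu ≠ 0) :
    False :=
  legged_a4N_ruleDP_vacuous h D hA (a4N_of_a4 D h4) (ruleDP_of_ruleD D hR) hμ

/-! ## §3 Door 1: the surplus rows beside `HallB136.HallUp` (hsemireg-monad-2 g6 `HallRows`, verbatim) -/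

/-- **Surplus row `HallPlusUp k`** (entry level, same shape as the tree's `HallB136.HallUp`): for every sub-list `S` of P-entries of POSITIVE total
mass and every list `T` of N-entries containing each N-entry weakly live above some entry of `S`, `Σ_S m + k ≤ Σ_T n`.
`k = 0` is `HallUp` (`hallUp_iff_hallPlusUp_zero`); `k = 8 = dim (E₀²)⁴` is monad-2's H_Hall⁺ = strengthen's PortHall₈ = the officer's HallPlus(8).
SCOPE (R19.615 (d)): necessary with full rigour exactly on column sets whose covering block is complete and four-ample (`HallPlusAmpleUp`,
Fulton–Lazarsfeld); on legged column sets it is the expected-dimension count — a CONJECTURAL-necessary row. -/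
def HallPlusUp (E : Design) (k : ℕ) : Prop :=
  ∀ S : List (Cell × ℕ), S.Sublist E.P → 0 < (S.map Prod.snd).sum →
    ∀ T : List (Cell × ℕ), T.Sublist E.N →
      (∀ cn ∈ E.N, (∃ cm ∈ S, WeakLive cm.1 cn.1) → cn ∈ T) →
        (S.map Prod.snd).sum + k ≤ (T.map Prod.snd).sum

/-- **Rigorous core `HallPlusAmpleUp k`**: the same surplus demand, only on column sets whose covering row list `T` is FOUR-AMPLE (`Live`) above
EVERY entry of `S`. -/
def HallPlusAmpleUp (E : Design) (k : ℕ) : Prop :=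
  ∀ S : List (Cell × ℕ), S.Sublist E.P → 0 < (S.map Prod.snd).sum →
    ∀ T : List (Cell × ℕ), T.Sublist E.N →
      (∀ cn ∈ E.N, (∃ cm ∈ S, WeakLive cm.1 cn.1) → cn ∈ T) →
        (∀ cm ∈ S, ∀ cn ∈ T, Live cm.1 cn.1) →
          (S.map Prod.snd).sum + k ≤ (T.map Prod.snd).sum

theorem hallPlusAmpleUp_of_hallPlusUp (E : Design) (k : ℕ) (h : HallPlusUp E k) : HallPlusAmpleUp E k :=
  fun S hS hpos T hT hcov _ => h S hS hpos T hT hcov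

theorem hallPlusUp_mono (E : Design) {k k' : ℕ} (hk : k ≤ k') (h : HallPlusUp E k') : HallPlusUp E k :=
  fun S hS hpos T hT hcov => le_trans (Nat.add_le_add_left hk _) (h S hS hpos T hT hcov)

theorem hallPlusAmpleUp_mono (E : Design) {k k' : ℕ} (hk : k ≤ k') (h : HallPlusAmpleUp E k') : HallPlusAmpleUp E k :=
  fun S hS hpos T hT hcov hlive => le_trans (Nat.add_le_add_left hk _) (h S hS hpos T hT hcov hlive)

/-- the `S = P`, `T = N` instance: `Σ_P m + k ≤ Σ_N n`. -/
theorem sumP_add_le_sumN_of_hallPlusUp (E : Design) (k : ℕ) (h : HallPlusUp E k) (hpos : 0 < (E.P.map Prod.snd).sum) :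
    (E.P.map Prod.snd).sum + k ≤ (E.N.map Prod.snd).sum :=
  h E.P (List.Sublist.refl _) hpos E.N (List.Sublist.refl _) (fun _ hcn _ => hcn)

/-- BRIDGE to the tree's door-1 name: `HallUp` is the surplus-`0` row (mass-zero column sets are trivial for `HallUp`). -/
theorem hallUp_iff_hallPlusUp_zero (E : Design) : HallUp E ↔ HallPlusUp E 0 := by
  constructor
  · intro h S hS _ T hT hcov
    rw [Nat.add_zero]
    exact h S hS T hT hcov
  · intro h S hS T hT hcov
    by_cases hpos : 0 < (S.map Prod.snd).sum
    · have := h S hS hpos T hT hcov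
      rw [Nat.add_zero] at this
      exact this
    · have h0 : (S.map Prod.snd).sum = 0 := by omega
      rw [h0]
      exact Nat.zero_le _

theorem hallUp_of_hallPlusUp (E : Design) (k : ℕ) (h : HallPlusUp E k) : HallUp E :=
  (hallUp_iff_hallPlusUp_zero E).mpr (hallPlusUp_mono E (Nat.zero_le k) h)

/-- the letter model's «8 ≤ rank» is the top instance of PortHall₈ (when the P side has positive mass). -/
theorem eight_le_rank_of_hallPlusUp (E : Design) (h : HallPlusUp E 8) (hpos : 0 < (E.P.map Prod.snd).sum) : 8 ≤ E.rank := by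
  have h8 := sumP_add_le_sumN_of_hallPlusUp E 8 h hpos
  unfold Design.rank
  omega

/-! ## §4 Transport of the door-1 rows along injective cell maps preserving the incidence, hence along the height tower (R19.614 (c)) -/

/-- the entry map of `mapD φ` (cells mapped, multiplicities kept). -/
def entryMap (φ : Cell → Cell) (cm : Cell × ℕ) : Cell × ℕ := (φ cm.1, cm.2)

theorem mapD_N (φ : Cell → Cell) (E : Design) : (mapD φ E).N = E.N.map (entryMap φ) := rfl

theorem mapD_P (φ : Cell → Cell) (E : Design) : (mapD φ E).P = E.P.map (entryMap φ) := rfl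

theorem map_snd_entryMap (φ : Cell → Cell) (L : List (Cell × ℕ)) : (L.map (entryMap φ)).map Prod.snd = L.map Prod.snd := by
  simp [entryMap, List.map_map, Function.comp_def]

theorem entryMap_injective {φ : Cell → Cell} (hφ : Function.Injective φ) : Function.Injective (entryMap φ) := by
  intro a b h
  simp only [entryMap, Prod.mk.injEq] at h
  exact Prod.ext (hφ h.1) h.2

/-- the covering clause transports forward along `entryMap φ`. -/
theorem cover_map {φ : Cell → Cell} (hW : ∀ x y, WeakLive (φ x) (φ y) ↔ WeakLive x y) (E : Design)
    (S T : List (Cell × ℕ)) (hcov : ∀ cn ∈ E.N, (∃ cm ∈ S, WeakLive cm.1 cn.1) → cn ∈ T) :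
    ∀ cn ∈ (mapD φ E).N, (∃ cm ∈ S.map (entryMap φ), WeakLive cm.1 cn.1) → cn ∈ T.map (entryMap φ) := by
  intro cn' hcn' hex
  rw [mapD_N, List.mem_map] at hcn'
  obtain ⟨cn, hcn, rfl⟩ := hcn'
  obtain ⟨cm', hcm', hw⟩ := hex
  obtain ⟨cm, hcm, rfl⟩ := List.mem_map.mp hcm'
  exact List.mem_map.mpr ⟨cn, hcov cn hcn ⟨cm, hcm, (hW cm.1 cn.1).mp hw⟩, rfl⟩

/-- … and backward when `φ` is injective. -/
theorem cover_of_map {φ : Cell → Cell} (hφ : Function.Injective φ) (hW : ∀ x y, WeakLive (φ x) (φ y) ↔ WeakLive x y)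
    (E : Design) (S T : List (Cell × ℕ))
    (hcov : ∀ cn ∈ (mapD φ E).N, (∃ cm ∈ S.map (entryMap φ), WeakLive cm.1 cn.1) → cn ∈ T.map (entryMap φ)) :
    ∀ cn ∈ E.N, (∃ cm ∈ S, WeakLive cm.1 cn.1) → cn ∈ T := by
  intro cn hcn hex
  obtain ⟨cm, hcm, hw⟩ := hex
  have hmem : entryMap φ cn ∈ T.map (entryMap φ) :=
    hcov (entryMap φ cn) (by rw [mapD_N]; exact List.mem_map.mpr ⟨cn, hcn, rfl⟩)
      ⟨entryMap φ cm, List.mem_map.mpr ⟨cm, hcm, rfl⟩, (hW cm.1 cn.1).mpr hw⟩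
  obtain ⟨cn₀, hcn₀, he⟩ := List.mem_map.mp hmem
  rw [← entryMap_injective hφ he]
  exact hcn₀

/-- `HallUp` transports along any injective cell map preserving `WeakLive`. -/
theorem hallUp_mapD {φ : Cell → Cell} (hφ : Function.Injective φ) (hW : ∀ x y, WeakLive (φ x) (φ y) ↔ WeakLive x y)
    (E : Design) : HallUp (mapD φ E) ↔ HallUp E := by
  constructor
  · intro h S hS T hT hcov
    have h' := h (S.map (entryMap φ)) (by rw [mapD_P]; exact hS.map _) (T.map (entryMap φ))
      (by rw [mapD_N]; exact hT.map _) (cover_map hW E S T hcov)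
    rwa [map_snd_entryMap, map_snd_entryMap] at h'
  · intro h S' hS' T' hT' hcov'
    rw [mapD_P] at hS'
    rw [mapD_N] at hT'
    obtain ⟨S, hS, rfl⟩ := List.sublist_map_iff.mp hS'
    obtain ⟨T, hT, rfl⟩ := List.sublist_map_iff.mp hT'
    rw [map_snd_entryMap, map_snd_entryMap]
    exact h S hS T hT (cover_of_map hφ hW E S T hcov')

/-- `HallPlusUp k` transports likewise. -/
theorem hallPlusUp_mapD {φ : Cell → Cell} (hφ : Function.Injective φ) (hW : ∀ x y, WeakLive (φ x) (φ y) ↔ WeakLive x y)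
    (E : Design) (k : ℕ) : HallPlusUp (mapD φ E) k ↔ HallPlusUp E k := by
  constructor
  · intro h S hS hpos T hT hcov
    have h' := h (S.map (entryMap φ)) (by rw [mapD_P]; exact hS.map _) (by rw [map_snd_entryMap]; exact hpos)
      (T.map (entryMap φ)) (by rw [mapD_N]; exact hT.map _) (cover_map hW E S T hcov)
    rwa [map_snd_entryMap, map_snd_entryMap] at h'
  · intro h S' hS' hpos' T' hT' hcov'
    rw [mapD_P] at hS'
    rw [mapD_N] at hT'
    obtain ⟨S, hS, rfl⟩ := List.sublist_map_iff.mp hS'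
    obtain ⟨T, hT, rfl⟩ := List.sublist_map_iff.mp hT'
    rw [map_snd_entryMap] at hpos'
    rw [map_snd_entryMap, map_snd_entryMap]
    exact h S hS hpos' T hT (cover_of_map hφ hW E S T hcov')

/-- `HallPlusAmpleUp k` transports along injective cell maps preserving `WeakLive` AND `Live`. -/
theorem hallPlusAmpleUp_mapD {φ : Cell → Cell} (hφ : Function.Injective φ) (hW : ∀ x y, WeakLive (φ x) (φ y) ↔ WeakLive x y)
    (hL : ∀ x y, Live (φ x) (φ y) ↔ Live x y) (E : Design) (k : ℕ) : HallPlusAmpleUp (mapD φ E) k ↔ HallPlusAmpleUp E k := by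
  constructor
  · intro h S hS hpos T hT hcov hlive
    have h' := h (S.map (entryMap φ)) (by rw [mapD_P]; exact hS.map _) (by rw [map_snd_entryMap]; exact hpos)
      (T.map (entryMap φ)) (by rw [mapD_N]; exact hT.map _) (cover_map hW E S T hcov) ?_
    · rwa [map_snd_entryMap, map_snd_entryMap] at h'
    · intro cm' hcm' cn' hcn'
      obtain ⟨cm, hcm, rfl⟩ := List.mem_map.mp hcm'
      obtain ⟨cn, hcn, rfl⟩ := List.mem_map.mp hcn'
      exact (hL cm.1 cn.1).mpr (hlive cm hcm cn hcn)
  · intro h S' hS' hpos' T' hT' hcov' hlive'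
    rw [mapD_P] at hS'
    rw [mapD_N] at hT'
    obtain ⟨S, hS, rfl⟩ := List.sublist_map_iff.mp hS'
    obtain ⟨T, hT, rfl⟩ := List.sublist_map_iff.mp hT'
    rw [map_snd_entryMap] at hpos'
    rw [map_snd_entryMap, map_snd_entryMap]
    refine h S hS hpos' T hT (cover_of_map hφ hW E S T hcov') ?_
    intro cm hcm cn hcn
    exact (hL cm.1 cn.1).mp (hlive' (entryMap φ cm) (List.mem_map.mpr ⟨cm, hcm, rfl⟩)
      (entryMap φ cn) (List.mem_map.mpr ⟨cn, hcn, rfl⟩))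

/-- door 1 is transported along the height tower. -/
theorem hallUp_shiftD (t : ℤ) (E : Design) : HallUp (shiftD t E) ↔ HallUp E :=
  hallUp_mapD (shiftCell_injective t) (weakLive_shiftCell t) E

theorem hallPlusUp_shiftD (t : ℤ) (E : Design) (k : ℕ) : HallPlusUp (shiftD t E) k ↔ HallPlusUp E k :=
  hallPlusUp_mapD (shiftCell_injective t) (weakLive_shiftCell t) E k

theorem hallPlusAmpleUp_shiftD (t : ℤ) (E : Design) (k : ℕ) : HallPlusAmpleUp (shiftD t E) k ↔ HallPlusAmpleUp E k :=
  hallPlusAmpleUp_mapD (shiftCell_injective t) (weakLive_shiftCell t) (live_shiftCell t) E k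

/-! ## §5 THE STATEMENT OF RECORD v4.1 (director-hodge R19.621 ∕ R19.625), typed as a `Prop` family — NOT registered as a stub (the ONE item waits for j341853) -/

/-- the cycle-door budget clause of record `Σ-H(D) + 28·(r − 4) + π ≤ 3 136`: `σ = Σ-H` is the CERTIFICATE-FED cycle-door functional (a parameter,
hsemireg-c4-1's to name; hsem-3's `extPN` is its decidable closed form on non-degenerate differences only) and `π` is semihom-1's PGL-PIECE RIDER, an
explicit parameter NOT baked in (R19.625 (i): `π = 0` for a rank-4-quotient zero locus, `π = 672 = 28·(5² − 1)` for a general `D₄(O⁵ → 𝓔)` presentation,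
pending c4-1's answer to semihom-1's Q3).  The `28·(r − 4)` term is closed-form arithmetic in `D.rank` (cf. `C4FrameCharge.covered_budget_iff`). -/
def BudgetClause (σ : Design → ℤ) (π : ℤ) (D : Design) : Prop := σ D + 28 * (D.rank - 4) + π ≤ 3136

/-- the sheaf-door count as a budget predicate (`copies ≤ B`; `B = 112 ∕ 199` is R19.623's question of record on ring 2). -/
def CopiesLe (B : ℕ) (D : Design) : Prop := D.copies ≤ B

/-- **the generic room**: height-`h` alphabet, (A1) (TREE form, R19.622), a DOOR predicate, the two door-1 rows (`HallUp` = HallEff, `HallPlusUp · 8` =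
PortHall₈), `μ ≠ 0`, a BUDGET predicate — jointly unsatisfiable.  The statement of record is the door `Disj ∧ RuleD` (`sPlusB_iff_room`); monad-2 g7's
§4 rider is the door `RuleDStrict` (`SPlusS`).  The height tower is proved ONCE for every shift-invariant door and budget (`room_succ_iff`). -/
def Room (h : ℤ) (Door Budget : Design → Prop) : Prop :=
  ∀ D : Design, D.OnAlphabet h → D.A1 → Door D → HallUp D → HallPlusUp D 8 → D.mu ≠ 0 → Budget D → False

/-- **S⁺(h) with a general budget predicate** (v4.1 hypothesis chain in the director's order): on the height-`h` alphabet no design with DISJOINT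
supports that is (A1)-clean (tree form), satisfies RULE D (door (H2)), Hall (door 1) and PortHall₈, has `μ ≠ 0`, and meets the budget. -/
def SPlusB (h : ℤ) (Budget : Design → Prop) : Prop :=
  ∀ D : Design, D.OnAlphabet h → Disj D → D.A1 → RuleD D → HallUp D → HallPlusUp D 8 → D.mu ≠ 0 → Budget D → False

/-- **S⁺(h) OF RECORD (v4.1)**: `OnAlphabet h ∧ Disj ∧ (A1) ∧ RuleD ∧ HallEff ∧ PortHall₈ ∧ μ ≠ 0 ∧ [Σ-H(D) + 28(r − 4) + π ≤ 3 136] ⇒ ⊥`.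
NON-VACUITY STATUS (honest): the door-and-(A1) part `OnAlphabet 14 ∧ Disj ∧ (A1) ∧ RuleD ∧ μ ≠ 0` is INHABITED on ring 2 (anomaly g14, R19.623, explicit
design, copies 13 106); Hall ∕ PortHall₈ ∕ Σ-H on that inhabitant are not computed, so whether the full hypothesis set is satisfiable — and at which
budget — is exactly the question j341853 ∕ the ring-2 scans decide; this file registers NO claim either way. -/
def SPlus (h : ℤ) (σ : Design → ℤ) (π : ℤ) : Prop := SPlusB h (BudgetClause σ π)

theorem sPlus_iff (h : ℤ) (σ : Design → ℤ) (π : ℤ) : SPlus h σ π ↔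
    ∀ D : Design, D.OnAlphabet h → Disj D → D.A1 → RuleD D → HallUp D → HallPlusUp D 8 → D.mu ≠ 0 →
      σ D + 28 * (D.rank - 4) + π ≤ 3136 → False := Iff.rfl

/-- the statement of record is the generic room with door `Disj ∧ RuleD`. -/
theorem sPlusB_iff_room (h : ℤ) (Budget : Design → Prop) : SPlusB h Budget ↔ Room h (fun D => Disj D ∧ RuleD D) Budget :=
  ⟨fun H D hA h1 hd hu hp hμ hb => H D hA hd.1 h1 hd.2 hu hp hμ hb,
    fun H D hA hd h1 hr hu hp hμ hb => H D hA h1 ⟨hd, hr⟩ hu hp hμ hb⟩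

/-- the `HallUp` conjunct is implied by PortHall₈ (both door-1 rows are kept because the statement of record lists both). -/
theorem sPlusB_iff_portHall (h : ℤ) (Budget : Design → Prop) : SPlusB h Budget ↔
    ∀ D : Design, D.OnAlphabet h → Disj D → D.A1 → RuleD D → HallPlusUp D 8 → D.mu ≠ 0 → Budget D → False :=
  ⟨fun H D hA hd h1 hr hp hμ hb => H D hA hd h1 hr (hallUp_of_hallPlusUp D 8 hp) hp hμ hb,
    fun H D hA hd h1 hr _ hp hμ hb => H D hA hd h1 hr hp hμ hb⟩

/-! ### monad-2 g7's §4 rider, typed (R19.625: «`Disj` (×3) stands; dual types both if cheap»): RULE D with suppliers distinct from the supplied cell -/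

/-- a STRICT supplier is a supplier different from the supplied cell («noself»; in a minimal display the `x = y` block is the zero matrix WLOG). -/
def SuppliesStrict (x y : Cell) (g j : Fin 4) : Prop := x ≠ y ∧ Supplies x y g j

/-- RULE D with strict suppliers (both clauses), NO disjointness axiom. -/
def RuleDStrict (D : Design) : Prop :=
  (∀ y ∈ D.suppN, ∀ g j : Fin 4, g < j → Detects y g j → ∃ x ∈ D.suppP, SuppliesStrict x y g j) ∧
  (∀ x ∈ D.suppP, ∀ g j : Fin 4, g < j → Detects x g j → ∃ y ∈ D.suppN, SuppliesStrict x y g j)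

theorem ruleD_of_ruleDStrict (D : Design) (h : RuleDStrict D) : RuleD D :=
  ⟨fun y hy g j hgj hd => by obtain ⟨x, hx, hs⟩ := h.1 y hy g j hgj hd; exact ⟨x, hx, hs.2⟩,
    fun x hx g j hgj hd => by obtain ⟨y, hy, hs⟩ := h.2 x hx g j hgj hd; exact ⟨y, hy, hs.2⟩⟩

/-- under `Disj` every supplier is strict, so the door of record implies the rider's door … -/
theorem ruleDStrict_of_disj_ruleD (D : Design) (hd : Disj D) (hr : RuleD D) : RuleDStrict D := by
  refine ⟨fun y hy g j hgj hdet => ?_, fun x hx g j hgj hdet => ?_⟩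
  · obtain ⟨x, hx, hs⟩ := hr.1 y hy g j hgj hdet
    refine ⟨x, hx, fun e => ?_, hs⟩
    rw [e] at hx
    exact hd y hy hx
  · obtain ⟨y, hy, hs⟩ := ruleDP_of_ruleD D hr x hx g j hgj hdet
    refine ⟨y, hy, fun e => ?_, hs⟩
    rw [e] at hx
    exact hd y hy hx

theorem shiftCell_eq_iff (t : ℤ) (x y : Cell) : shiftCell t x = shiftCell t y ↔ x = y := (shiftCell_injective t).eq_iff

theorem suppliesStrict_shiftCell (t : ℤ) (x y : Cell) (g j : Fin 4) :
    SuppliesStrict (shiftCell t x) (shiftCell t y) g j ↔ SuppliesStrict x y g j := by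
  simp only [SuppliesStrict, ne_eq, shiftCell_eq_iff, supplies_shiftCell]

theorem ruleDStrict_shiftD (t : ℤ) (D : Design) : RuleDStrict (shiftD t D) ↔ RuleDStrict D := by
  simp only [RuleDStrict, suppN_shift, suppP_shift, List.forall_mem_map, exists_mem_map_iff', suppliesStrict_shiftCell,
    detects_shiftCell]

/-- **S⁺ˢ(h)** — the rider's form of the item: door `RuleDStrict` in place of `Disj ∧ RuleD` (a strictly WEAKER hypothesis set, hence a STRONGER statement,
`sPlusB_of_sPlusS`); it still kills the DOUBLED-CHIRAL ghosts, whose only suppliers are themselves (monad-2 g7 §4). -/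
def SPlusS (h : ℤ) (Budget : Design → Prop) : Prop :=
  ∀ D : Design, D.OnAlphabet h → D.A1 → RuleDStrict D → HallUp D → HallPlusUp D 8 → D.mu ≠ 0 → Budget D → False

theorem sPlusS_iff_room (h : ℤ) (Budget : Design → Prop) : SPlusS h Budget ↔ Room h RuleDStrict Budget := Iff.rfl

/-- … so the rider's statement implies the statement of record (same height, same budget). -/
theorem sPlusB_of_sPlusS {h : ℤ} {Budget : Design → Prop} (H : SPlusS h Budget) : SPlusB h Budget :=
  fun D hA hd h1 hr hu hp hμ hb => H D hA h1 (ruleDStrict_of_disj_ruleD D hd hr) hu hp hμ hb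

/-! ### monotonicity in the budget -/

theorem room_mono_budget {h : ℤ} {Door B B' : Design → Prop} (hBB : ∀ D, B D → B' D) (H : Room h Door B') : Room h Door B :=
  fun D hA h1 hd hu hp hμ hb => H D hA h1 hd hu hp hμ (hBB D hb)

/-- weakening the budget predicate strengthens the statement: `S⁺` is antitone in `Budget`. -/
theorem sPlusB_mono {h : ℤ} {B B' : Design → Prop} (hBB : ∀ D, B D → B' D) (H : SPlusB h B') : SPlusB h B :=
  fun D hA hd h1 hr hu hp hμ hb => H D hA hd h1 hr hu hp hμ (hBB D hb)

/-- the budget-free room implies every budgeted one. -/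
theorem sPlusB_of_budgetFree {h : ℤ} (H : SPlusB h fun _ => True) (Budget : Design → Prop) : SPlusB h Budget :=
  sPlusB_mono (fun _ _ => trivial) H

/-- a larger PGL rider only shrinks the budgeted family: `S⁺(h, σ, π) ⇒ S⁺(h, σ, π')` for `π ≤ π'`. -/
theorem sPlus_mono_rider {h : ℤ} (σ : Design → ℤ) {π π' : ℤ} (hπ : π ≤ π') (H : SPlus h σ π) : SPlus h σ π' :=
  sPlusB_mono (fun D (hb : BudgetClause σ π' D) => show BudgetClause σ π D by unfold BudgetClause at hb ⊢; omega) H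

/-- the copies count is monotone the other way: `S⁺(h, copies ≤ B') ⇒ S⁺(h, copies ≤ B)` for `B ≤ B'`. -/
theorem sPlusB_copiesLe_mono {h : ℤ} {B B' : ℕ} (hB : B ≤ B') (H : SPlusB h (CopiesLe B')) : SPlusB h (CopiesLe B) :=
  sPlusB_mono (fun D (hb : CopiesLe B D) => show CopiesLe B' D from le_trans hb hB) H

/-- PortHall₈ gives the rank floor `8 ≤ rank` on a non-empty P side (`eight_le_rank_of_hallPlusUp`). -/
theorem rank_floor_in_sPlus_room (D : Design) (hp : HallPlusUp D 8) (hpos : 0 < (D.P.map Prod.snd).sum) : 8 ≤ D.rank :=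
  eight_le_rank_of_hallPlusUp D hp hpos

/-- On the (A4).2 sub-room the item holds outright at every height and budget (§2): the content of `S⁺` is on the LEGGED room. -/
theorem sPlusB_on_a4N (h : ℤ) (Budget : Design → Prop) :
    ∀ D : Design, D.OnAlphabet h → A4N D → RuleD D → D.mu ≠ 0 → Budget D → False :=
  fun D hA hC hR hμ _ => legged_a4N_ruleDP_vacuous h D hA hC (ruleDP_of_ruleD D hR) hμ

/-! ### The height tower, proved ONCE for the generic room (every added hypothesis is transported: `a1_shiftD`, the door's own shift lemma
(`disj_shiftD` ∧ `ruleD_shiftD`, or `ruleDStrict_shiftD`), `hallUp_shiftD`, `hallPlusUp_shiftD`, `mu_shiftD`; the budget predicate is the one side condition) -/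

/-- DOWN-INHERITANCE: a design at height `h` shifts up to height `h + t`. -/
theorem room_of_room_up {h : ℤ} (t : ℤ) (ht : 0 ≤ t) {Door Budget : Design → Prop}
    (hDoor : ∀ D : Design, Door D → Door (shiftD t D)) (hB : ∀ D : Design, Budget D → Budget (shiftD t D))
    (H : Room (h + t) Door Budget) : Room h Door Budget := by
  intro D hA h1 hd hu hp hμ hb
  exact H (shiftD t D) (onAlphabet_shift_up D h t ht hA) (a1_shiftD t D h1) (hDoor D hd) ((hallUp_shiftD t D).mpr hu)
    ((hallPlusUp_shiftD t D 8).mpr hp) (by rw [mu_shiftD]; exact hμ) (hB D hb)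

/-- FLOOR-FREE(h) for the generic room: every design of the room at height `h` avoids the floor letters (`a = 0`). -/
def FloorFreeR (h : ℤ) (Door Budget : Design → Prop) : Prop :=
  ∀ D : Design, D.OnAlphabet h → D.A1 → Door D → HallUp D → HallPlusUp D 8 → D.mu ≠ 0 → Budget D →
    ∀ c ∈ D.suppN ++ D.suppP, ∀ f : Fin 4, 0 < (c f).a

theorem floorFreeR_of_room {h : ℤ} {Door Budget : Design → Prop} (H : Room h Door Budget) : FloorFreeR h Door Budget :=
  fun D hA h1 hd hu hp hμ hb => (H D hA h1 hd hu hp hμ hb).elim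

/-- THE INDUCTIVE STEP: `Room(h)` and FLOOR-FREE(h + 1) ⇒ `Room(h + 1)` (a floor-free design shifts down one storey). -/
theorem room_succ_of {h : ℤ} {Door Budget : Design → Prop} (hDoor : ∀ D : Design, Door D → Door (shiftD (-1) D))
    (hB : ∀ D : Design, Budget D → Budget (shiftD (-1) D)) (H : Room h Door Budget) (hf : FloorFreeR (h + 1) Door Budget) :
    Room (h + 1) Door Budget := by
  intro D hA h1 hd hu hp hμ hb
  have hpos := hf D hA h1 hd hu hp hμ hb
  refine H (shiftD (-1) D) ?_ (a1_shiftD (-1) D h1) (hDoor D hd) ((hallUp_shiftD (-1) D).mpr hu)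
    ((hallPlusUp_shiftD (-1) D 8).mpr hp) (by rw [mu_shiftD]; exact hμ) (hB D hb)
  have hA' := onAlphabet_shift D (h + 1) (-1) hA (fun c hc f => by have := hpos c hc f; omega)
  have e : h + 1 + (-1) = h := by ring
  rw [e] at hA'
  exact hA'

/-- ONE STOREY: `Room(h + 1) ↔ Room(h) ∧ FLOOR-FREE(h + 1)`, for any shift-invariant door and budget. -/
theorem room_succ_iff (h : ℤ) {Door Budget : Design → Prop} (hDoor : ∀ (t : ℤ) (D : Design), Door (shiftD t D) ↔ Door D)
    (hB : ∀ (t : ℤ) (D : Design), Budget (shiftD t D) ↔ Budget D) :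
    Room (h + 1) Door Budget ↔ Room h Door Budget ∧ FloorFreeR (h + 1) Door Budget :=
  ⟨fun H => ⟨room_of_room_up 1 (by norm_num) (fun D hd => (hDoor 1 D).mpr hd) (fun D hb => (hB 1 D).mpr hb) H, floorFreeR_of_room H⟩,
    fun hh => room_succ_of (fun D hd => (hDoor (-1) D).mpr hd) (fun D hb => (hB (-1) D).mpr hb) hh.1 hh.2⟩

/-- THE TOWER over `n` storeys. -/
theorem room_add_iff (h : ℤ) {Door Budget : Design → Prop} (hDoor : ∀ (t : ℤ) (D : Design), Door (shiftD t D) ↔ Door D)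
    (hB : ∀ (t : ℤ) (D : Design), Budget (shiftD t D) ↔ Budget D) (n : ℕ) :
    Room (h + n) Door Budget ↔ Room h Door Budget ∧ ∀ j : ℕ, j < n → FloorFreeR (h + j + 1) Door Budget := by
  induction n with
  | zero => simp
  | succ n ih =>
    have e : h + ((n + 1 : ℕ) : ℤ) = (h + n) + 1 := by push_cast; ring
    rw [e, room_succ_iff _ hDoor hB, ih]
    constructor
    · rintro ⟨⟨hn, hF⟩, hf⟩
      refine ⟨hn, fun j hj => ?_⟩
      rcases Nat.lt_succ_iff_lt_or_eq.mp hj with hj | rfl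
      · exact hF j hj
      · exact hf
    · rintro ⟨hn, hF⟩
      exact ⟨⟨hn, fun j hj => hF j (Nat.lt_succ_of_lt hj)⟩, hF n (Nat.lt_succ_self n)⟩

/-! ### instances: the door of record, the rider's door, the budget clause of record, the copies count -/

theorem doorOfRecord_shiftD (t : ℤ) (D : Design) : (Disj (shiftD t D) ∧ RuleD (shiftD t D)) ↔ (Disj D ∧ RuleD D) :=
  and_congr (disj_shiftD t D) (ruleD_shiftD t D)

/-- the budget clause of record is shift-invariant as soon as Σ-H is (the `28·(r − 4)` term only sees `rank`: `rank_shift`). -/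
theorem budgetClause_shiftD (σ : Design → ℤ) (π : ℤ) (hσ : ∀ (t : ℤ) (D : Design), σ (shiftD t D) = σ D) (t : ℤ) (D : Design) :
    BudgetClause σ π (shiftD t D) ↔ BudgetClause σ π D := by
  unfold BudgetClause
  rw [hσ, rank_shift]

theorem copiesLe_shiftD (B : ℕ) (t : ℤ) (D : Design) : CopiesLe B (shiftD t D) ↔ CopiesLe B D := by
  unfold CopiesLe
  rw [copies_shift]

/-- a PAIR-SUM functional `Σ_{(p,m) ∈ P} Σ_{(ν,n) ∈ N} m·n·κ(p,ν)` — the shape of hsem-3's decidable `extPN E d` (memo-153 `B136SigmaBudget`,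
`κ p ν := if pairDeg p ν = d then pairDim p ν else 0`) and of the door-0 ∕ Σ-H digits `28·copies + extPN D 1`; typed here only to discharge the
tower's side condition `σ (shiftD t D) = σ D` once and for all for kernels that see differences of letters only. -/
def pairSum (κ : Cell → Cell → ℕ) (E : Design) : ℕ :=
  (E.P.map fun pm => (E.N.map fun nm => pm.2 * nm.2 * κ pm.1 nm.1).sum).sum

theorem pairSum_mapD (κ : Cell → Cell → ℕ) (φ : Cell → Cell) (hκ : ∀ x y, κ (φ x) (φ y) = κ x y) (E : Design) :
    pairSum κ (mapD φ E) = pairSum κ E := by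
  simp only [pairSum, mapD_P, mapD_N, List.map_map, Function.comp_def, entryMap, hκ]

theorem pairSum_shiftD (κ : Cell → Cell → ℕ) (hκ : ∀ (t : ℤ) (x y : Cell), κ (shiftCell t x) (shiftCell t y) = κ x y) (t : ℤ)
    (E : Design) : pairSum κ (shiftD t E) = pairSum κ E :=
  pairSum_mapD κ (shiftCell t) (hκ t) E

/-- the door-0-shaped functional `28·copies + pairSum κ` (hsem-3 memo-153: `28·136 + extPN D 1 = 3 808 + 12 288` on B136). -/
def copiesPairSigma (κ : Cell → Cell → ℕ) (D : Design) : ℤ := 28 * (D.copies : ℤ) + (pairSum κ D : ℤ)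

theorem copiesPairSigma_shiftD (κ : Cell → Cell → ℕ) (hκ : ∀ (t : ℤ) (x y : Cell), κ (shiftCell t x) (shiftCell t y) = κ x y)
    (t : ℤ) (D : Design) : copiesPairSigma κ (shiftD t D) = copiesPairSigma κ D := by
  unfold copiesPairSigma
  rw [copies_shift, pairSum_shiftD κ hκ]

/-- FLOOR-FREE⁺(h) for the statement of record. -/
def FloorFreeB (h : ℤ) (Budget : Design → Prop) : Prop := FloorFreeR h (fun D => Disj D ∧ RuleD D) Budget

/-- DOWN-INHERITANCE for `S⁺` with any budget predicate stable under up-shifts. -/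
theorem sPlusB_of_sPlusB_up {h : ℤ} (t : ℤ) (ht : 0 ≤ t) {Budget : Design → Prop}
    (hB : ∀ D : Design, Budget D → Budget (shiftD t D)) (H : SPlusB (h + t) Budget) : SPlusB h Budget := by
  rw [sPlusB_iff_room] at H ⊢
  exact room_of_room_up t ht (fun D hd => (doorOfRecord_shiftD t D).mpr hd) hB H

/-- ONE STOREY for `S⁺`: `S⁺(h + 1) ↔ S⁺(h) ∧ FLOOR-FREE⁺(h + 1)`, for any shift-invariant budget predicate. -/
theorem sPlusB_succ_iff (h : ℤ) {Budget : Design → Prop} (hB : ∀ (t : ℤ) (D : Design), Budget (shiftD t D) ↔ Budget D) :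
    SPlusB (h + 1) Budget ↔ SPlusB h Budget ∧ FloorFreeB (h + 1) Budget := by
  rw [sPlusB_iff_room, sPlusB_iff_room]
  exact room_succ_iff h doorOfRecord_shiftD hB

/-- THE TOWER for `S⁺` over `n` storeys. -/
theorem sPlusB_add_iff (h : ℤ) {Budget : Design → Prop} (hB : ∀ (t : ℤ) (D : Design), Budget (shiftD t D) ↔ Budget D) (n : ℕ) :
    SPlusB (h + n) Budget ↔ SPlusB h Budget ∧ ∀ j : ℕ, j < n → FloorFreeB (h + j + 1) Budget := by
  rw [sPlusB_iff_room, sPlusB_iff_room]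
  exact room_add_iff h doorOfRecord_shiftD hB n

/-- ONE STOREY for the statement of record. -/
theorem sPlus_succ_iff (h : ℤ) (σ : Design → ℤ) (π : ℤ) (hσ : ∀ (t : ℤ) (D : Design), σ (shiftD t D) = σ D) :
    SPlus (h + 1) σ π ↔ SPlus h σ π ∧ FloorFreeB (h + 1) (BudgetClause σ π) :=
  sPlusB_succ_iff h (budgetClause_shiftD σ π hσ)

/-- THE TOWER for the statement of record. -/
theorem sPlus_add_iff (h : ℤ) (σ : Design → ℤ) (π : ℤ) (hσ : ∀ (t : ℤ) (D : Design), σ (shiftD t D) = σ D) (n : ℕ) :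
    SPlus (h + n) σ π ↔ SPlus h σ π ∧ ∀ j : ℕ, j < n → FloorFreeB (h + j + 1) (BudgetClause σ π) :=
  sPlusB_add_iff h (budgetClause_shiftD σ π hσ) n

/-- DOWN-INHERITANCE for the statement of record. -/
theorem sPlus_of_sPlus_up {h : ℤ} (t : ℤ) (ht : 0 ≤ t) (σ : Design → ℤ) (π : ℤ)
    (hσ : ∀ (t : ℤ) (D : Design), σ (shiftD t D) = σ D) (H : SPlus (h + t) σ π) : SPlus h σ π :=
  sPlusB_of_sPlusB_up t ht (fun D hb => (budgetClause_shiftD σ π hσ t D).mpr hb) H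

/-- the copies-count instances (`copies ≤ B` is shift-invariant). -/
theorem sPlusB_copiesLe_succ_iff (h : ℤ) (B : ℕ) :
    SPlusB (h + 1) (CopiesLe B) ↔ SPlusB h (CopiesLe B) ∧ FloorFreeB (h + 1) (CopiesLe B) :=
  sPlusB_succ_iff h (copiesLe_shiftD B)

/-- ONE STOREY ∕ THE TOWER for the rider's form. -/
theorem sPlusS_succ_iff (h : ℤ) {Budget : Design → Prop} (hB : ∀ (t : ℤ) (D : Design), Budget (shiftD t D) ↔ Budget D) :
    SPlusS (h + 1) Budget ↔ SPlusS h Budget ∧ FloorFreeR (h + 1) RuleDStrict Budget :=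
  room_succ_iff h ruleDStrict_shiftD hB

theorem sPlusS_add_iff (h : ℤ) {Budget : Design → Prop} (hB : ∀ (t : ℤ) (D : Design), Budget (shiftD t D) ↔ Budget D) (n : ℕ) :
    SPlusS (h + n) Budget ↔ SPlusS h Budget ∧ ∀ j : ℕ, j < n → FloorFreeR (h + j + 1) RuleDStrict Budget :=
  room_add_iff h ruleDStrict_shiftD hB n

/-! ## §6 The B136 object against the doors (kernel facts already in the tree, cited by name; nothing re-decided) -/

/-- door 1 fails on B136 at h = 9 and on its height-14 shift (tree `HallB136.not_hallUp`, `not_hallUp_h14`); by §3 every PortHall row fails too. -/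
theorem not_hallPlusUp_B136 (k : ℕ) : ¬ HallPlusUp B136 k :=
  fun h => not_hallUp (hallUp_of_hallPlusUp B136 k h)

theorem not_hallPlusUp_B136h14 (k : ℕ) : ¬ HallPlusUp B136h14 k :=
  fun h => not_hallUp_h14 (hallUp_of_hallPlusUp B136h14 k h)

end Summit.HodgeConjecture.HodgeConjecture.Cruxes.BlochSeedDiscOne.RuleDPlate
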